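import Mathlib

/-!
# The `O(P)` advection is invisible in a symmetrised energy (solo-blind, PLATEAU (PL-2)/complement averaging theorem, paper §24.95(9))

For the frozen ideal chain `A = A₀ + iP·H` (real `A₀`, `H`) and a real diagonal weight `W` such that
`W H` is symmetric (kernel #163 gives `W = diag(m² - 1)` on the rolls, `W = 1` on the streaks), the
weighted energy `E(x) = Σ_i W_i |x_i|²` evolves WITHOUT the `O(P)` term:
`Re Σ_i conj(x_i) W_i (A x)_i = Re Σ_i conj(x_i) W_i (A₀ x)_i`, because the Hermitian form of the real
symmetric matrix `W H` is real.  Pure algebra over `Fin n → ℂ`.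
-/

namespace Summit.AnomalousDissipation.AnomalousDissipation.Theorems

open Complex

variable {n : ℕ}

/-- The sesquilinear form of a real symmetric matrix takes real values: its imaginary part vanishes. -/
theorem symmForm_im_eq_zero (S : Matrix (Fin n) (Fin n) ℝ) (hS : S.IsSymm) (x : Fin n → ℂ) :
    (∑ i, ∑ j, (starRingEnd ℂ) (x i) * (S i j : ℂ) * x j).im = 0 := by
  have key : ∑ i, ∑ j, (starRingEnd ℂ) (x i) * (S i j : ℂ) * x j =
      ∑ i, ∑ j, x i * (S i j : ℂ) * (starRingEnd ℂ) (x j) := by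
    rw [Finset.sum_comm]
    refine Finset.sum_congr rfl (fun i _ => Finset.sum_congr rfl (fun j _ => ?_))
    have hij : S j i = S i j := by
      have := congrFun (congrFun hS i) j
      simpa [Matrix.transpose_apply] using this
    rw [hij]; ring
  -- the sum equals its own conjugate
  have hconj : (starRingEnd ℂ) (∑ i, ∑ j, (starRingEnd ℂ) (x i) * (S i j : ℂ) * x j) =
      ∑ i, ∑ j, (starRingEnd ℂ) (x i) * (S i j : ℂ) * x j := by
    rw [map_sum]
    conv_rhs => rw [key]
    refine Finset.sum_congr rfl (fun i _ => ?_)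
    rw [map_sum]
    refine Finset.sum_congr rfl (fun j _ => ?_)
    simp [map_mul, Complex.conj_ofReal, mul_comm]
  exact Complex.conj_eq_iff_im.mp hconj

/-- **Weighted energy identity.** With `A x = A₀ x + (I·P) • H x` and `W H` symmetric (`W` a real
diagonal weight), the `O(P)` advection drops out of `Re ⟨x, W A x⟩`. -/
theorem weightedEnergy_advection_invisible (A₀ H : Matrix (Fin n) (Fin n) ℝ) (W : Fin n → ℝ) (P : ℝ)
    (hWH : (Matrix.of fun i j => W i * H i j).IsSymm) (x : Fin n → ℂ) :
    (∑ i, (starRingEnd ℂ) (x i) * (W i : ℂ) *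
        ((A₀.map ((↑) : ℝ → ℂ)).mulVec x i + (I * P) * (H.map ((↑) : ℝ → ℂ)).mulVec x i)).re =
      (∑ i, (starRingEnd ℂ) (x i) * (W i : ℂ) * (A₀.map ((↑) : ℝ → ℂ)).mulVec x i).re := by
  -- the `H`-part of the weighted pairing is the Hermitian form of `W H`
  have hH : ∀ i, (starRingEnd ℂ) (x i) * (W i : ℂ) * (H.map ((↑) : ℝ → ℂ)).mulVec x i =
      ∑ j, (starRingEnd ℂ) (x i) * ((W i * H i j : ℝ) : ℂ) * x j := by
    intro i
    simp only [Matrix.mulVec, dotProduct, Matrix.map_apply, Complex.ofReal_mul]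
    rw [Finset.mul_sum]
    refine Finset.sum_congr rfl (fun j _ => ?_)
    ring
  have hsplit : ∑ i, (starRingEnd ℂ) (x i) * (W i : ℂ) *
        ((A₀.map ((↑) : ℝ → ℂ)).mulVec x i + (I * P) * (H.map ((↑) : ℝ → ℂ)).mulVec x i) =
      (∑ i, (starRingEnd ℂ) (x i) * (W i : ℂ) * (A₀.map ((↑) : ℝ → ℂ)).mulVec x i) +
        (I * P) * ∑ i, ∑ j, (starRingEnd ℂ) (x i) * ((W i * H i j : ℝ) : ℂ) * x j := by
    have hterm : ∀ i, (starRingEnd ℂ) (x i) * (W i : ℂ) *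
        ((A₀.map ((↑) : ℝ → ℂ)).mulVec x i + (I * P) * (H.map ((↑) : ℝ → ℂ)).mulVec x i) =
        (starRingEnd ℂ) (x i) * (W i : ℂ) * (A₀.map ((↑) : ℝ → ℂ)).mulVec x i +
          (I * P) * ((starRingEnd ℂ) (x i) * (W i : ℂ) * (H.map ((↑) : ℝ → ℂ)).mulVec x i) := by
      intro i; ring
    simp_rw [hterm]
    rw [Finset.sum_add_distrib, ← Finset.mul_sum]
    congr 2
    exact Finset.sum_congr rfl (fun i _ => hH i)
  have him := symmForm_im_eq_zero (Matrix.of fun i j => W i * H i j) hWH x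
  simp only [Matrix.of_apply] at him
  rw [hsplit, Complex.add_re]
  have hz : ((I * P) * ∑ i, ∑ j, (starRingEnd ℂ) (x i) * ((W i * H i j : ℝ) : ℂ) * x j).re = 0 := by
    set z := ∑ i, ∑ j, (starRingEnd ℂ) (x i) * ((W i * H i j : ℝ) : ℂ) * x j with hzdef
    have : z.im = 0 := him
    simp [Complex.mul_re, this]
  rw [hz, add_zero]

end Summit.AnomalousDissipation.AnomalousDissipation.Theorems
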